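import Summits.QuantumFields.YangMills.Theorems.BalabanUVNodesN19LipschitzLinksMomentBudgetLog
import Summits.QuantumFields.YangMills.Theorems.BalabanUVNodesN19ModulusLinkJacksonSmoothing
import Summits.QuantumFields.YangMills.Theorems.BalabanUVNodesN19LipschitzLinksMomentFirstOrderLocal

/-!
# YM-DAG node N19 (= NE7 proper) — THE MODULUS THEOREM IN THE MOMENT CURRENCY
# (`e^{−L}`-close mixed moments, `L ≥ 2^20` ⇒ `|∫h(S_d)dP − ∫h(S_d)dQ| ≤ 720·K·d∕L + 7.8·10⁵·μ·d·log₂L∕L`, `μ` = oscillation of `h′` at scale `18000·d·log₂L∕L`)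

Cell `pub-ymgap`, HUMAN RULING D-0062 (Track A) ∕ D-0149, R141 (C) seat `pub-ymgap-dag-n19-e` (s3 = ALTERNATIVE CURRENCY), generation g35,
module 11 (lineage module 195).  Route `Summits/QuantumFields/YangMills/Theses/BalabanUVNodes.lean`, cluster item K3⁸ «SpineGivenEndpointR13SepCoPHV»
(stmt-QuantumFields-27366); filed `--supports` that item `--as helper` (it proves no registered stub).  COUNT-NEUTRAL: [folklore]∕[bookkeeping] over the
lineage BY NAME — module 192 (`exists_trigLink_near_modulusLink_jackson`), module 194 (`exists_mvPolynomial_near_trigLink_firstOrder_mass_local`), module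
179 (`logb_le_L20`, `exists_parameters_L1`), PART 2c (`exists_additiveJackson_mass`), module 127 (`mass_add_le`, `mass_mul_le`, `mass_C_le`), module 146
(`abs_integral_sub_le_of_near_mass`), modules 120∕125∕98 (`l1Norm_mem_Icc`, `continuous_l1Norm`, `integrable_of_continuous_of_cube`); TOY laws on the cube
under a HYPOTHESIS of close mixed moments; no scheme object, no Theses import; NOT a discharge claim.

THE RESULT.  Module 189 (the `C²` moment row) re-run with module 192's smoothing under a MODULUS of `h′` and module 194's localised law (`R = μ·dπ∕2^J`,
`dπ∕2^J ≤ d∕L_F`) at module 179's parameters: sup error `≤ 162Kd∕L + 3.9·10⁵μd·log₂L∕L` (§1 `errorBound_modulus_L1`: smoothing `7π⁴dμ∕(32L_F)` and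
remainder `μd∕(2πL_F)` carry `1∕L_F ≤ 18000log₂L∕L`), mass as in module 189.  ★★★ `abs_integral_modulusLink_l1Norm_sub_le_of_closeMoments`: for laws on
`[−1,1]^ι` with `e^{−L}`-close mixed moments (`L ≥ 2^20`) and `h` with a continuous derivative `h′` everywhere, `|h′| ≤ K` on `[0, d]`, and
`|h′(s) − h′(s′)| ≤ μ` whenever `s, s′ ∈ [0, d]`, `|s − s′| ≤ 18000·d·log₂L∕L`: **`|∫h(Σ|x_i|)dP − ∫h(Σ|x_i|)dQ| ≤ 720·K·d∕L + 7.8·10⁵·μ·d·log₂L∕L`** —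
with module 193 (degree model) the modulus theorem holds in BOTH currencies: the logarithm of the Lipschitz rows (176∕180) multiplies only the
oscillation of `h′` inside one window of length `≍ d·log∕budget`.

HONEST FRAMING (binding).  Elementary and [folklore]; ONE construction, constants astronomical; NO consumer in the DAG today; nothing of Bałaban's
instantiated; NE7 NOT PRINTED, NOT proved; N19 NOT discharged; count-neutral.  One finite `T⁴` programme at fixed `ε`; nothing continuum ∕ `ℝ⁴` ∕ OS ∕
mass-gap ∕ Clay.  0 `def` ∕ 0 `sorry`.
-/

noncomputable section

open Finset MeasureTheory
open scoped Real

namespace Summit.QuantumFields.YangMills.Theorems.BalabanUVNodesN19ModulusLinksMomentBudget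

open Summit.QuantumFields.YangMills.Theorems.BalabanUVNodesN19MomentBudgetLinearParameters (logb_le_L20 exists_parameters_L1)
open Summit.QuantumFields.YangMills.Theorems.BalabanUVNodesN19LipschitzLinksMomentFirstOrderLocal (exists_mvPolynomial_near_trigLink_firstOrder_mass_local)
open Summit.QuantumFields.YangMills.Theorems.BalabanUVNodesN19ModulusLinkJacksonSmoothing (exists_trigLink_near_modulusLink_jackson)
open Summit.QuantumFields.YangMills.Theorems.BalabanUVNodesN19SingleModeMomentLadder (exists_additiveJackson_mass)
open Summit.QuantumFields.YangMills.Theorems.BalabanUVNodesN19CoefficientMassPricing (mass_add_le mass_mul_le mass_C_le)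
open Summit.QuantumFields.YangMills.Theorems.BalabanUVNodesN19SingleModeMomentLogFreeBudget (abs_integral_sub_le_of_near_mass)
open Summit.QuantumFields.YangMills.Theorems.BalabanUVNodesN19OscillatingLinksMomentDiscrepancy (continuous_l1Norm)
open Summit.QuantumFields.YangMills.Theorems.BalabanUVNodesN19OscillatingLinksMultiscale (l1Norm_mem_Icc)
open Summit.QuantumFields.YangMills.Theorems.BalabanUVNodesN19JointLawBernstein (integrable_of_continuous_of_cube)

variable {ι : Type*} [Fintype ι]

/-! ## §1 The sup-error bookkeeping at budget `L` [bookkeeping] -/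

/-- THE SUP-ERROR BOOKKEEPING AT BUDGET `L` (module 179's parameters, module 192's data; `M = 2^J ≥ 2π²L_F`, `ε ≤ 1∕(2L²)`, `12000ΛL_F ≤ L ≤ 18000ΛL_F`,
`L∕17 ≤ N`): smoothing `7π⁴dμ∕(32L_F) ≤ 383600μdΛ∕L`, remainder `μ·dπ∕M ≤ μd∕(2πL_F) ≤ 2866μdΛ∕L`; first order `2K·dπ∕N ≤ 34πKd∕L`, chord
`K·dπ∕N ≤ 17πKd∕L`, ladder `≤ Kd∕L`; total `≤ 162Kd∕L + 390000μdΛ∕L`. [bookkeeping] -/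
theorem errorBound_modulus_L1 {K μ d L Λ LF M N ε : ℝ} (hK : 0 ≤ K) (hμ : 0 ≤ μ) (hd : 0 < d) (hL : 1048576 ≤ L) (hΛ : 20 ≤ Λ) (hLF1 : 1 ≤ LF)
    (hLFL : 12000 * Λ * LF ≤ L) (hLLF : L ≤ 18000 * Λ * LF) (hM : 2 * LF * π * π ≤ M) (hMN : M ≤ N) (hN17 : L / 17 ≤ N)
    (hε : ε ≤ 1 / (2 * L ^ 2)) :
    7 * π ^ 4 * d * μ / (32 * LF) +
      (μ * (d * π / M) + 2 * K * (d * π / N) +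
        ε * (π ^ 4 * (K * d) * LF / 2) * (1 + 2 * LF * π / d * (d * π / M + d * π / N))) + K * (d * (π / N)) ≤
        162 * K * d / L + 390000 * μ * d * Λ / L := by
  have hπlo : 3.14 < π := Real.pi_gt_d2
  have hπhi : π < 3.15 := Real.pi_lt_d2
  have hπ := Real.pi_pos
  have hL0 : 0 < L := by linarith
  have hLF0 : 0 < LF := by linarith
  have hM0 : 0 < M := lt_of_lt_of_le (by positivity) hM
  have hN0 : 0 < N := lt_of_lt_of_le (by positivity) hN17
  have hKd : 0 ≤ K * d := mul_nonneg hK hd.le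
  have hμd : 0 ≤ μ * d := mul_nonneg hμ hd.le
  have hΛ0 : 0 < Λ := by linarith
  have hinvL : 1 / LF ≤ 18000 * Λ / L := by
    rw [div_le_div_iff₀ hLF0 hL0, one_mul]; exact hLLF
  -- smoothing
  have hπhi4 : π < 3.1416 := Real.pi_lt_d4
  have hπ2 : π ^ 2 < 3.1416 * 3.1416 := by rw [pow_two]; exact mul_lt_mul'' hπhi4 hπhi4 hπ.le hπ.le
  have hπ4 : π ^ 4 ≤ 97.42 := by nlinarith only [hπ2, pow_pos hπ 2]
  have hT1 : 7 * π ^ 4 * d * μ / (32 * LF) ≤ 383600 * μ * d * Λ / L := by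
    have e : 7 * π ^ 4 * d * μ / (32 * LF) = μ * d * (7 * π ^ 4 / 32) * (1 / LF) := by field_simp
    rw [e]
    calc μ * d * (7 * π ^ 4 / 32) * (1 / LF) ≤ μ * d * (7 * 97.42 / 32) * (18000 * Λ / L) :=
          mul_le_mul (mul_le_mul_of_nonneg_left (by linarith only [hπ4]) hμd) hinvL (by positivity) (by positivity)
      _ ≤ 383600 * μ * d * Λ / L := by
          rw [show μ * d * (7 * 97.42 / 32) * (18000 * Λ / L) = (7 * 97.42 / 32 * 18000) * (μ * d * Λ) / L by ring]
          exact div_le_div_of_nonneg_right (by nlinarith only [hμd, hΛ0]) hL0.le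
  -- remainder (`M ≥ 2π²L_F`)
  have hT2 : μ * (d * π / M) ≤ 2866 * μ * d * Λ / L := by
    have h1 : d * π / M ≤ d * π / (2 * LF * π * π) := div_le_div_of_nonneg_left (by positivity) (by positivity) hM
    have e : d * π / (2 * LF * π * π) = d / (2 * π) * (1 / LF) := by field_simp
    have h2 : d / (2 * π) * (1 / LF) ≤ d / (2 * π) * (18000 * Λ / L) := mul_le_mul_of_nonneg_left hinvL (by positivity)
    have h3 : d / (2 * π) * (18000 * Λ / L) ≤ 2866 * d * Λ / L := by
      rw [show d / (2 * π) * (18000 * Λ / L) = (18000 / (2 * π)) * (d * Λ) / L by field_simp,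
        show 2866 * d * Λ / L = 2866 * (d * Λ) / L by ring]
      refine div_le_div_of_nonneg_right (mul_le_mul_of_nonneg_right ?_ (by positivity)) hL0.le
      have hπlo4 : 3.1415 < π := Real.pi_gt_d4
      rw [div_le_iff₀ (by positivity)]; nlinarith only [hπlo4]
    calc μ * (d * π / M) ≤ μ * (2866 * d * Λ / L) := mul_le_mul_of_nonneg_left ((h1.trans e.le).trans (h2.trans h3)) hμ
      _ = 2866 * μ * d * Λ / L := by ring
  -- first order and chord (`dπ/N ≤ 17πd/L`)
  have hdN : d * π / N ≤ 17 * π * d / L := by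
    rw [div_le_div_iff₀ hN0 hL0]
    have e2 := mul_le_mul_of_nonneg_left hN17 (by positivity : (0 : ℝ) ≤ 17 * π * d)
    have e3 : 17 * π * d * (L / 17) = d * π * L := by ring
    linarith only [e2, e3]
  have hT3 : 2 * K * (d * π / N) ≤ 34 * π * (K * d) / L := by
    calc 2 * K * (d * π / N) ≤ 2 * K * (17 * π * d / L) := mul_le_mul_of_nonneg_left hdN (by positivity)
      _ = 34 * π * (K * d) / L := by ring
  have hT5 : K * (d * (π / N)) ≤ 17 * π * (K * d) / L := by
    calc K * (d * (π / N)) = K * (d * π / N) := by ring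
      _ ≤ K * (17 * π * d / L) := mul_le_mul_of_nonneg_left hdN hK
      _ = 17 * π * (K * d) / L := by ring
  -- ladder
  have hT4 : ε * (π ^ 4 * (K * d) * LF / 2) * (1 + 2 * LF * π / d * (d * π / M + d * π / N)) ≤ K * d / L := by
    have h1 : 2 * LF * π / d * (d * π / M) ≤ 1 := by
      rw [show 2 * LF * π / d * (d * π / M) = 2 * LF * π * π / M by field_simp, div_le_one hM0]; exact hM
    have h2 : 2 * LF * π / d * (d * π / N) ≤ 1 := by
      rw [show 2 * LF * π / d * (d * π / N) = 2 * LF * π * π / N by field_simp, div_le_one hN0]; exact hM.trans hMN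
    have h3 : 1 + 2 * LF * π / d * (d * π / M + d * π / N) ≤ 3 := by rw [mul_add]; linarith only [h1, h2]
    have hW : π ^ 4 * (K * d) * LF / 2 ≤ 49.25 * (K * d) * LF := by
      rw [div_le_iff₀ (by norm_num : (0 : ℝ) < 2)]
      have := mul_le_mul_of_nonneg_right hπ4 (by positivity : (0 : ℝ) ≤ K * d * LF)
      have h0 : 0 ≤ K * d * LF := by positivity
      nlinarith only [this, h0]
    have h03 : (0 : ℝ) ≤ 1 + 2 * LF * π / d * (d * π / M + d * π / N) := by positivity
    have h4 : ε * (π ^ 4 * (K * d) * LF / 2) * (1 + 2 * LF * π / d * (d * π / M + d * π / N)) ≤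
        (1 / (2 * L ^ 2)) * (49.25 * (K * d) * LF) * 3 :=
      mul_le_mul (mul_le_mul hε hW (by positivity) (by positivity)) h3 h03 (by positivity)
    refine h4.trans ?_
    rw [show 1 / (2 * L ^ 2) * (49.25 * (K * d) * LF) * 3 = 73.875 * K * d * LF / L ^ 2 by field_simp; ring,
      div_le_div_iff₀ (by positivity) hL0]
    have hLsmall : 240000 * LF ≤ L := by nlinarith only [hLFL, hΛ, hLF0]
    have := mul_le_mul_of_nonneg_left hLsmall (by positivity : (0 : ℝ) ≤ K * d * L)
    nlinarith only [this, hKd, hL0, hLF0]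
  have hsum : 383600 * μ * d * Λ / L + (2866 * μ * d * Λ / L + 34 * π * (K * d) / L + K * d / L) +
      17 * π * (K * d) / L ≤ 162 * K * d / L + 390000 * μ * d * Λ / L := by
    have e1 : 34 * π * (K * d) / L + K * d / L + 17 * π * (K * d) / L ≤ 162 * K * d / L := by
      rw [← add_div, ← add_div]
      refine div_le_div_of_nonneg_right ?_ hL0.le
      nlinarith only [hπhi, hKd]
    have e2 : 383600 * μ * d * Λ / L + 2866 * μ * d * Λ / L ≤ 390000 * μ * d * Λ / L := by
      rw [← add_div]
      exact div_le_div_of_nonneg_right (by nlinarith only [hμd, hΛ0]) hL0.le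
    linarith only [e1, e2]
  linarith only [hT1, hT2, hT3, hT4, hT5, hsum]

/-! ## §2 ★★★ The modulus theorem in the moment currency [folklore] -/

variable [Nonempty ι]

/-- ★★★ **THE MODULUS THEOREM IN THE MOMENT CURRENCY.**  Let `P, Q` be probability laws on `ℝ^ι` carried by `[−1,1]^ι` (`d = |ι| ≥ 1`) whose mixed
moments are ALL `e^{−L}`-close, `L ≥ 2^20`; let `h : ℝ → ℝ` have a continuous derivative `h′` everywhere with `|h′| ≤ K` on `[0, d]`, and let `μ` satisfy
`|h′(s) − h′(s′)| ≤ μ` whenever `s, s′ ∈ [0, d]` and `|s − s′| ≤ 18000·d·log₂L∕L`.  Then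
**`|∫h(Σ_i|x_i|)dP − ∫h(Σ_i|x_i|)dQ| ≤ 720·K·d∕L + 7.8·10⁵·μ·d·log₂L∕L`** (`μ = 2K`: module 180's row up to the constant; `|h″| ≤ κ`:
`μ = 18000κd·log₂L∕L`, module 189's shape; Hölder∕Dini `h′`: log-free). [folklore] -/
theorem abs_integral_modulusLink_l1Norm_sub_le_of_closeMoments {P Q : Measure (ι → ℝ)} [IsProbabilityMeasure P] [IsProbabilityMeasure Q]
    (hP : P (Set.pi Set.univ (fun _ : ι => Set.Icc (-1 : ℝ) 1))ᶜ = 0) (hQ : Q (Set.pi Set.univ (fun _ : ι => Set.Icc (-1 : ℝ) 1))ᶜ = 0)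
    {L : ℝ} (hL : (2 : ℝ) ^ (20 : ℕ) ≤ L) (hmom : ∀ j : ι → ℕ, |∫ x, ∏ i, x i ^ j i ∂P - ∫ x, ∏ i, x i ^ j i ∂Q| ≤ Real.exp (-L))
    {h h' : ℝ → ℝ} (hh : ∀ s, HasDerivAt h (h' s) s) (hh'c : Continuous h')
    {K μ : ℝ} (hK : ∀ s ∈ Set.Icc (0 : ℝ) (Fintype.card ι), |h' s| ≤ K)
    (hμ : ∀ s s', s ∈ Set.Icc (0 : ℝ) (Fintype.card ι) → s' ∈ Set.Icc (0 : ℝ) (Fintype.card ι) →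
      |s - s'| ≤ 18000 * Fintype.card ι * Real.logb 2 L / L → |h' s - h' s'| ≤ μ) :
    |∫ x, h (∑ i, |x i|) ∂P - ∫ x, h (∑ i, |x i|) ∂Q| ≤
      720 * K * Fintype.card ι / L + 780000 * μ * Fintype.card ι * Real.logb 2 L / L := by
  set d : ℝ := (Fintype.card ι : ℝ) with hdd
  have hd : 0 < d := by rw [hdd]; exact_mod_cast Fintype.card_pos
  have hL0 : 0 < L := lt_of_lt_of_le (by positivity) hL
  have hLge : (1048576 : ℝ) ≤ L := le_trans (by norm_num) hL
  have h0mem : (0 : ℝ) ∈ Set.Icc (0 : ℝ) d := ⟨le_rfl, hd.le⟩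
  have hK0 : 0 ≤ K := (abs_nonneg _).trans (hK 0 h0mem)
  obtain ⟨hΛ20, _, _⟩ := logb_le_L20 hL
  have hwin0 : 0 ≤ 18000 * d * Real.logb 2 L / L := div_nonneg (mul_nonneg (mul_nonneg (by norm_num) hd.le) (by linarith)) hL0.le
  have hμ0 : 0 ≤ μ := (abs_nonneg _).trans (hμ 0 0 h0mem h0mem (by rw [sub_self, abs_zero]; exact hwin0))
  obtain ⟨LF, J, hh₀, N, hLF1, hLLF, hLFL, hh1, hJh, hexph, hJ1, hLππ, hNJ, hN17, hbudget⟩ := exists_parameters_L1 hL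
  have hLFr : (1 : ℝ) ≤ LF := by exact_mod_cast hLF1
  have hLF0 : (0 : ℝ) < LF := by linarith
  have hLFL' : (LF : ℝ) ≤ L := by
    have h1 : (1 : ℝ) ≤ 12000 * Real.logb 2 L := by nlinarith only [hΛ20]
    exact (le_mul_of_one_le_left (by positivity) h1).trans hLFL
  -- the modulus at scale `d/L_F ≤ 18000·d·log₂L/L`
  have hinvLF : 1 / (LF : ℝ) ≤ 18000 * Real.logb 2 L / L := by rw [div_le_div_iff₀ hLF0 hL0, one_mul]; exact hLLF
  have hdL : d / LF ≤ 18000 * d * Real.logb 2 L / L := by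
    calc d / LF = d * (1 / LF) := by ring
      _ ≤ d * (18000 * Real.logb 2 L / L) := mul_le_mul_of_nonneg_left hinvLF hd.le
      _ = 18000 * d * Real.logb 2 L / L := by ring
  have hμL : ∀ s s', s ∈ Set.Icc (0 : ℝ) d → s' ∈ Set.Icc (0 : ℝ) d → |s - s'| ≤ d / LF → |h' s - h' s'| ≤ μ :=
    fun s s' hs hs' hss' => hμ s s' hs hs' (hss'.trans hdL)
  -- the smoothing of the de-trended link on `[0, d]`
  obtain ⟨α, β, ω, g, g₁, hω0, hωΩ, hW, hg, hg₁, hC1, hB1, hlam, herr⟩ := exists_trigLink_near_modulusLink_jackson hd hh hh'c hK hLF1 hμL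
  have hΩ : (0 : ℝ) ≤ 2 * LF * π / d := by positivity
  -- the localised remainder at scale `dπ/2^J ≤ d/L_F`
  have h2J : (0 : ℝ) < 2 ^ J := by positivity
  have hscale : d * π / 2 ^ J ≤ d / LF := by
    rw [div_le_div_iff₀ h2J hLF0]
    have h1 : π ≤ 2 * π * π := by nlinarith only [Real.pi_gt_three]
    calc d * π * LF = (d * LF) * π := by ring
      _ ≤ (d * LF) * (2 * π * π) := mul_le_mul_of_nonneg_left h1 (by positivity)
      _ = d * (2 * LF * π * π) := by ring
      _ ≤ d * 2 ^ J := mul_le_mul_of_nonneg_left hLππ hd.le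
  have hC11 : ∀ u a, |u - a| ≤ Fintype.card ι * π / 2 ^ J → |g u - g a - g₁ a * (u - a)| ≤ μ * (d * π / 2 ^ J) := by
    intro u a hua
    rw [← hdd] at hua
    exact (hC1 u a (hua.trans hscale)).trans (mul_le_mul_of_nonneg_left hua hμ0)
  -- the polynomial with mass for the trigonometric part
  obtain ⟨F, hFmass, hFerr⟩ := exists_mvPolynomial_near_trigLink_firstOrder_mass_local (ι := ι)
    (((range LF ×ˢ range LF) ×ˢ (range LF ×ˢ range LF)) ×ˢ (Finset.univ : Finset Bool)) 0 α β ω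
    (Ω := 2 * LF * π / d) (W := π ^ 4 * (K * d) * LF / 2) (B₁ := 2 * K) hg hg₁ hΩ hω0 hωΩ hW hB1 J hh₀ N hh1 hJh hNJ hC11
  -- the chord with mass
  have hNpos : 0 < N := by
    have h1 : (0 : ℝ) < N := lt_of_lt_of_le (by positivity) hN17
    exact_mod_cast h1
  obtain ⟨A, hAmass, hAerr⟩ := exists_additiveJackson_mass (ι := ι) hNpos
  -- the sup error on the cube
  have hS := fun (x : ι → ℝ) (hx : ∀ i, x i ∈ Set.Icc (-1 : ℝ) 1) => l1Norm_mem_Icc x hx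
  have hε : 2 * ((J : ℝ) + 1) * Real.exp (-(hh₀ : ℝ)) ≤ 1 / (2 * L ^ 2) := by
    calc 2 * ((J : ℝ) + 1) * Real.exp (-(hh₀ : ℝ)) ≤ 2 * (L / 4) * (1 / L ^ 3) := by
          have := mul_le_mul hJ1 hexph (Real.exp_pos _).le (by positivity)
          linarith only [this]
      _ = 1 / (2 * L ^ 2) := by field_simp; ring
  have hNJr : ((2 : ℝ) ^ J) ≤ N := by exact_mod_cast hNJ
  have hη := errorBound_modulus_L1 (M := (2 : ℝ) ^ J) (ε := 2 * ((J : ℝ) + 1) * Real.exp (-(hh₀ : ℝ))) hK0 hμ0 hd hLge hΛ20 hLFr hLFL hLLF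
    hLππ hNJr hN17 hε
  have happ : ∀ x : ι → ℝ, (∀ i, x i ∈ Set.Icc (-1 : ℝ) 1) →
      |(h (∑ i, |x i|) - h 0) - MvPolynomial.eval x (MvPolynomial.C ((h d - h 0) / d) * A + F)| ≤
        162 * K * d / L + 390000 * μ * d * Real.logb 2 L / L := by
    intro x hx
    have h1 := herr (∑ i, |x i|) (by rw [hdd]; exact ⟨(hS x hx).1, (hS x hx).2⟩)
    have h2 := hFerr x hx
    have h3 := hAerr x hx
    rw [← hdd] at h2 h3
    have hchord : |(h d - h 0) / d * (∑ i, |x i|) - (h d - h 0) / d * MvPolynomial.eval x A| ≤ K * (d * (π / N)) := by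
      rw [← mul_sub, abs_mul]
      exact mul_le_mul hlam h3 (abs_nonneg _) hK0
    have hev : MvPolynomial.eval x (MvPolynomial.C ((h d - h 0) / d) * A + F) = (h d - h 0) / d * MvPolynomial.eval x A + MvPolynomial.eval x F := by
      simp only [map_add, map_mul, MvPolynomial.eval_C]
    rw [hev]
    have esplit : (h (∑ i, |x i|) - h 0) - ((h d - h 0) / d * MvPolynomial.eval x A + MvPolynomial.eval x F) =
        (h (∑ i, |x i|) - h 0 - (h d - h 0) / d * (∑ i, |x i|) - g (∑ i, |x i|)) +
          ((h d - h 0) / d * (∑ i, |x i|) - (h d - h 0) / d * MvPolynomial.eval x A) + ((g (∑ i, |x i|) - 0) - MvPolynomial.eval x F) := by ring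
    rw [esplit]
    calc |(h (∑ i, |x i|) - h 0 - (h d - h 0) / d * (∑ i, |x i|) - g (∑ i, |x i|)) +
          ((h d - h 0) / d * (∑ i, |x i|) - (h d - h 0) / d * MvPolynomial.eval x A) + ((g (∑ i, |x i|) - 0) - MvPolynomial.eval x F)|
        ≤ |h (∑ i, |x i|) - h 0 - (h d - h 0) / d * (∑ i, |x i|) - g (∑ i, |x i|)| +
          |(h d - h 0) / d * (∑ i, |x i|) - (h d - h 0) / d * MvPolynomial.eval x A| + |(g (∑ i, |x i|) - 0) - MvPolynomial.eval x F| :=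
          (abs_add_le _ _).trans (add_le_add (abs_add_le _ _) le_rfl)
      _ ≤ 7 * π ^ 4 * d * μ / (32 * LF) + K * (d * (π / N)) +
          (μ * (d * π / 2 ^ J) + 2 * K * (d * π / N) +
            2 * ((J : ℝ) + 1) * Real.exp (-(hh₀ : ℝ)) * (π ^ 4 * (K * d) * LF / 2) *
              (1 + 2 * LF * π / d * (d * π / 2 ^ J + d * π / N))) := add_le_add (add_le_add h1 hchord) h2
      _ ≤ 162 * K * d / L + 390000 * μ * d * Real.logb 2 L / L := by linarith only [hη]
  -- the mass budget
  have h2L : L ^ 2 * Real.exp (-(L / 2)) ≤ 8 := by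
    have h3 : (L / 2) ^ 2 / 2 ≤ Real.exp (L / 2) := by
      have := Real.quadratic_le_exp_of_nonneg (show 0 ≤ L / 2 by positivity)
      linarith
    rw [Real.exp_neg]
    have h4 : 0 < Real.exp (L / 2) := Real.exp_pos _
    rw [mul_inv_le_iff₀ h4]
    nlinarith only [h3]
  have hexp8 : Real.exp (-(L / 2)) ≤ 8 / L ^ 2 := by
    rw [le_div_iff₀ (by positivity)]; linarith only [h2L, show Real.exp (-(L / 2)) * L ^ 2 = L ^ 2 * Real.exp (-(L / 2)) by ring]
  have h2πL : 2 / (π * L) ≤ 1 := by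
    rw [div_le_one (by positivity)]; nlinarith only [Real.pi_gt_three, hLge]
  have eΩ : 2 * LF * π / d * (Fintype.card ι : ℝ) = 2 * LF * π := by rw [← hdd]; field_simp
  rw [eΩ] at hFmass
  have hexpB : Real.exp (((J : ℝ) + 1) * Real.log 2 + (6 * π * Real.exp 2 * (2 * LF * π) + hh₀ * ((J : ℝ) + 1)) * Real.log (1 + 10 * (2 * LF * π)) +
        (3 * π * Real.exp 2 * (2 * LF * π) * ((J : ℝ) + 1) + hh₀ * (2 ^ (J + 1) - 1)) * Real.log 81) *
      (1 + 2 * (2 * LF * π) * (N * 9 ^ N)) ≤ Real.exp (L / 2) := by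
    rw [← Real.exp_log (show (0 : ℝ) < 1 + 2 * (2 * LF * π) * (N * 9 ^ N) by positivity), ← Real.exp_add]
    exact Real.exp_le_exp.2 hbudget
  have hmassF : (∑ s ∈ F.support, |F.coeff s|) * Real.exp (-L) ≤ 4 * π ^ 4 * K * d / L := by
    have hW0 : 0 ≤ π ^ 4 * (K * d) * (LF : ℝ) / 2 := by positivity
    have h1 : (∑ s ∈ F.support, |F.coeff s|) ≤ π ^ 4 * (K * d) * LF / 2 * Real.exp (L / 2) := by
      refine hFmass.trans ?_
      rw [mul_assoc]
      exact mul_le_mul_of_nonneg_left hexpB hW0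
    calc (∑ s ∈ F.support, |F.coeff s|) * Real.exp (-L) ≤ π ^ 4 * (K * d) * LF / 2 * Real.exp (L / 2) * Real.exp (-L) :=
          mul_le_mul_of_nonneg_right h1 (Real.exp_pos _).le
      _ = π ^ 4 * (K * d) * LF / 2 * Real.exp (-(L / 2)) := by rw [mul_assoc, ← Real.exp_add]; ring_nf
      _ ≤ π ^ 4 * (K * d) * L / 2 * Real.exp (-(L / 2)) := by
          have := mul_le_mul_of_nonneg_right hLFL' (by positivity : (0 : ℝ) ≤ π ^ 4 * (K * d) / 2 * Real.exp (-(L / 2)))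
          nlinarith only [this]
      _ = π ^ 4 * (K * d) / 2 / L * (L ^ 2 * Real.exp (-(L / 2))) := by field_simp
      _ ≤ π ^ 4 * (K * d) / 2 / L * 8 := mul_le_mul_of_nonneg_left h2L (by positivity)
      _ = 4 * π ^ 4 * K * d / L := by ring
  -- the chord's mass: `N·9^N ≤ e^{L/2}/(4π)` from the same budget
  have hN9 : (N : ℝ) * 9 ^ N ≤ Real.exp (L / 2) / (4 * π) := by
    have hl2 : 0 ≤ Real.log 2 := Real.log_nonneg (by norm_num)
    have h10 : (0 : ℝ) ≤ 10 * (2 * LF * π) := by positivity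
    have hl10 : 0 ≤ Real.log (1 + 10 * (2 * LF * π)) := Real.log_nonneg (by linarith only [h10])
    have hl81 : 0 ≤ Real.log 81 := Real.log_nonneg (by norm_num)
    have hJ2 : (0 : ℝ) ≤ 2 ^ (J + 1) - 1 := by have : (1 : ℝ) ≤ 2 ^ (J + 1) := one_le_pow₀ (by norm_num); linarith
    have hA1 : 0 ≤ ((J : ℝ) + 1) * Real.log 2 := mul_nonneg (by positivity) hl2
    have hA2 : 0 ≤ (6 * π * Real.exp 2 * (2 * LF * π) + hh₀ * ((J : ℝ) + 1)) * Real.log (1 + 10 * (2 * LF * π)) :=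
      mul_nonneg (by positivity) hl10
    have hA3 : 0 ≤ (3 * π * Real.exp 2 * (2 * LF * π) * ((J : ℝ) + 1) + hh₀ * (2 ^ (J + 1) - 1)) * Real.log 81 :=
      mul_nonneg (add_nonneg (by positivity) (mul_nonneg (by positivity) hJ2)) hl81
    have hpos : (1 : ℝ) ≤ Real.exp (((J : ℝ) + 1) * Real.log 2 + (6 * π * Real.exp 2 * (2 * LF * π) + hh₀ * ((J : ℝ) + 1)) *
        Real.log (1 + 10 * (2 * LF * π)) + (3 * π * Real.exp 2 * (2 * LF * π) * ((J : ℝ) + 1) + hh₀ * (2 ^ (J + 1) - 1)) * Real.log 81) :=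
      Real.one_le_exp (add_nonneg (add_nonneg hA1 hA2) hA3)
    have hc0 : (0 : ℝ) ≤ 1 + 2 * (2 * LF * π) * (N * 9 ^ N) := by positivity
    have h1 : 1 + 2 * (2 * LF * π) * (N * 9 ^ N) ≤ Real.exp (L / 2) := (le_mul_of_one_le_left hc0 hpos).trans hexpB
    have hprod : 0 ≤ π * ((N : ℝ) * 9 ^ N) := by positivity
    have h2 : π * ((N : ℝ) * 9 ^ N) ≤ LF * (π * ((N : ℝ) * 9 ^ N)) := le_mul_of_one_le_left hprod hLFr
    rw [le_div_iff₀ (by positivity)]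
    linarith only [h1, h2]
  have hmassA : (∑ s ∈ (MvPolynomial.C ((h d - h 0) / d) * A).support, |(MvPolynomial.C ((h d - h 0) / d) * A).coeff s|) * Real.exp (-L) ≤
      K * d / L := by
    have h1 : (∑ s ∈ (MvPolynomial.C ((h d - h 0) / d) * A).support, |(MvPolynomial.C ((h d - h 0) / d) * A).coeff s|) ≤
        K * (d * (N * 9 ^ N)) := by
      refine (mass_mul_le _ _).trans ?_
      rw [← hdd] at hAmass
      exact mul_le_mul ((mass_C_le _).trans hlam) hAmass (Finset.sum_nonneg fun _ _ => abs_nonneg _) hK0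
    calc (∑ s ∈ (MvPolynomial.C ((h d - h 0) / d) * A).support, |(MvPolynomial.C ((h d - h 0) / d) * A).coeff s|) * Real.exp (-L)
        ≤ K * (d * (N * 9 ^ N)) * Real.exp (-L) := mul_le_mul_of_nonneg_right h1 (Real.exp_pos _).le
      _ ≤ K * (d * (Real.exp (L / 2) / (4 * π))) * Real.exp (-L) :=
          mul_le_mul_of_nonneg_right (mul_le_mul_of_nonneg_left (mul_le_mul_of_nonneg_left hN9 hd.le) hK0) (Real.exp_pos _).le
      _ = K * d / (4 * π) * (Real.exp (L / 2) * Real.exp (-L)) := by ring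
      _ = K * d / (4 * π) * Real.exp (-(L / 2)) := by rw [← Real.exp_add]; ring_nf
      _ ≤ K * d / (4 * π) * (8 / L ^ 2) := mul_le_mul_of_nonneg_left hexp8 (by positivity)
      _ = K * d / L * (2 / (π * L)) := by field_simp; ring
      _ ≤ K * d / L * 1 := mul_le_mul_of_nonneg_left h2πL (by positivity)
      _ = K * d / L := mul_one _
  have hmass : (∑ s ∈ (MvPolynomial.C ((h d - h 0) / d) * A + F).support, |(MvPolynomial.C ((h d - h 0) / d) * A + F).coeff s|) *
      Real.exp (-L) ≤ K * d / L + 4 * π ^ 4 * K * d / L := by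
    have := mul_le_mul_of_nonneg_right (mass_add_le (MvPolynomial.C ((h d - h 0) / d) * A) F) (Real.exp_pos (-L)).le
    rw [add_mul] at this
    exact this.trans (add_le_add hmassA hmassF)
  -- the price
  have hc : Continuous h := continuous_iff_continuousAt.2 fun s => (hh s).continuousAt
  have hcont : Continuous fun x : ι → ℝ => h (∑ i, |x i|) := hc.comp continuous_l1Norm
  have hg0 : Continuous fun x : ι → ℝ => h (∑ i, |x i|) - h 0 := hcont.sub continuous_const
  have hprice := abs_integral_sub_le_of_near_mass hP hQ (Real.exp_pos _).le hmom hg0 happ le_rfl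
  have hconst : ∫ x, h (∑ i, |x i|) ∂P - ∫ x, h (∑ i, |x i|) ∂Q =
      ∫ x, (h (∑ i, |x i|) - h 0) ∂P - ∫ x, (h (∑ i, |x i|) - h 0) ∂Q := by
    rw [integral_sub (integrable_of_continuous_of_cube hP hcont) (integrable_const _),
      integral_sub (integrable_of_continuous_of_cube hQ hcont) (integrable_const _)]
    simp only [MeasureTheory.integral_const, smul_eq_mul, probReal_univ]
    ring
  rw [hconst]
  refine hprice.trans ?_
  have hKd : 0 ≤ K * d := mul_nonneg hK0 hd.le
  have hπ4 : π ^ 4 ≤ 98.5 := by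
    have hπhi : π < 3.15 := Real.pi_lt_d2
    have hπ2 : π ^ 2 < 3.15 * 3.15 := by rw [pow_two]; exact mul_lt_mul'' hπhi hπhi Real.pi_pos.le Real.pi_pos.le
    nlinarith only [hπ2, pow_pos Real.pi_pos 2]
  rw [hdd] at hmass ⊢
  refine (add_le_add le_rfl hmass).trans ?_
  rw [← hdd]
  have e : 2 * (162 * K * d / L + 390000 * μ * d * Real.logb 2 L / L) + (K * d / L + 4 * π ^ 4 * K * d / L) =
      (325 * K * d + 4 * π ^ 4 * K * d) / L + 780000 * μ * d * Real.logb 2 L / L := by ring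
  rw [e]
  refine add_le_add ?_ le_rfl
  refine div_le_div_of_nonneg_right ?_ hL0.le
  have hx : π ^ 4 * K * d ≤ 98.5 * (K * d) := by
    have := mul_le_mul_of_nonneg_right hπ4 hKd
    linarith only [this, show π ^ 4 * K * d = π ^ 4 * (K * d) by ring]
  nlinarith only [hKd, hx]

end Summit.QuantumFields.YangMills.Theorems.BalabanUVNodesN19ModulusLinksMomentBudget

end
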